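import Literature.Analysis.FluidPDE.PassiveScalarShearFibreDamping
import HarnessLib
import Summits.AnomalousDissipation.AnomalousDissipation.Theses.SawtoothPulseCascade

/-!
# K1loc, line `Spectral` — helper: from a tracked smooth symbol to the stub's `highModeEnergy` (the last conversion)

Helper file of the first prover lane on the crux `K1LocalisedCascade` (stmt-AnomalousDissipation-19491), route
`SawtoothPulseCascade`.  The line tracks, phase by phase, the weighted energy `∑ₖ m_k² ‖𝓕w(k)‖²` of a smooth "bad-set"
symbol `m` (memo F-a / NET S3e); the registered stub `stub_highModeConcentration` is stated with the tree's streamwise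
block energy `Torus.highModeEnergy i K` (`PassiveScalarShearFibreDamping`).  This file records the one-line conversion
between the two at the final phase, where the bad symbol dominates the low block (`m_k² ≥ 1` for `|k_i| < K`):

* `scalarL2Sq_eq_tsum_sq_norm_mFourierCoeff` — Parseval for a continuous real scalar in the tree's vocabulary:
  `‖θ‖²_{L²} = ∑ₖ ‖𝓕(↑θ)(k)‖²`;
* `scalarL2Sq_sub_tsum_symbol_sq_le_highModeEnergy` — **`ofReal(‖θ‖² − ∑ₖ m_k²‖𝓕θ(k)‖²) ≤ highModeEnergy i K θ`** for a
  bounded real symbol with `m_k² ≥ 1` on the low block `|k_i| < K`.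

With the registered composition's energy identity (`energyIdentityE` of the skeleton) this turns a bound
`∑ m_J²‖𝓕w(t_J)‖² ≤ (1 − 2χ)‖θ₀‖²` into the stub's conclusion `2χ‖θ₀‖² ≤ highModeEnergy K (w t_J) + 2·dissipation`.
WHAT THIS IS NOT: no statement about the cascade.  [cite: Grafakos2014, Prop. 3.2.7 (3) (Parseval)] [problem: turb]
-/

-- `Summit.<Summit>.<Problem>`: single-conjunct summit, the duplicate namespace segment is deliberate.
set_option linter.dupNamespace false

noncomputable section

namespace Summit.AnomalousDissipation.AnomalousDissipation.Theorems.SawtoothPulseCascade.SpectralLeakage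

open MeasureTheory Set Filter Topology UnitAddTorus Complex
open scoped ENNReal
open Literature.Analysis Literature.Analysis.FunctionSpaces Literature.Analysis.FluidPDE
open Literature.Analysis.FunctionSpaces.Torus
open Literature.Analysis.FluidPDE.Torus (highModeEnergy highModeEnergy_eq_ofReal_tsum)

variable {d : Type*} [Fintype d] [DecidableEq d]

omit [DecidableEq d] in
/-- **Parseval in the tree's scalar vocabulary**: for a continuous real `θ`, `scalarL2Sq θ = ∑ₖ ‖𝓕(↑θ)(k)‖²`, with the
`HasSum` form. [cite: Grafakos2014, Prop. 3.2.7 (3) (Parseval)] -/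
theorem hasSum_sq_norm_mFourierCoeff_scalarL2Sq {θ : UnitAddTorus d → ℝ} (hθ : Continuous θ) :
    HasSum (fun k => ‖mFourierCoeff (fun x => (θ x : ℂ)) k‖ ^ 2) (Torus.scalarL2Sq θ) := by
  have h := hasSum_sq_mFourierCoeff_of_continuous (continuous_ofReal.comp hθ)
  have hint : ∫ x, ‖((θ x : ℝ) : ℂ)‖ ^ 2 = Torus.scalarL2Sq θ := by
    unfold Torus.scalarL2Sq
    refine integral_congr_ae (ae_of_all _ fun x => ?_)
    show ‖((θ x : ℝ) : ℂ)‖ ^ 2 = θ x ^ 2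
    rw [Complex.norm_real, Real.norm_eq_abs, sq_abs]
  rw [← hint]
  exact h

omit [DecidableEq d] in
/-- `scalarL2Sq θ = ∑ₖ ‖𝓕(↑θ)(k)‖²` for continuous real `θ`. [cite: Grafakos2014, Prop. 3.2.7 (3) (Parseval)] -/
theorem scalarL2Sq_eq_tsum_sq_norm_mFourierCoeff {θ : UnitAddTorus d → ℝ} (hθ : Continuous θ) :
    Torus.scalarL2Sq θ = ∑' k, ‖mFourierCoeff (fun x => (θ x : ℂ)) k‖ ^ 2 :=
  (hasSum_sq_norm_mFourierCoeff_scalarL2Sq hθ).tsum_eq.symm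

omit [DecidableEq d] in
/-- **From a tracked symbol to the high block.**  Let `θ` be a continuous real scalar, `m` a real symbol with `|m| ≤ M`
and `m_k² ≥ 1` whenever `|k_i| < K`.  Then `ofReal(‖θ‖²_{L²} − ∑ₖ m_k² ‖𝓕(↑θ)(k)‖²) ≤ highModeEnergy i K θ`:
whatever the bad symbol does not see sits in the streamwise block `|k_i| ≥ K`. [cite: Grafakos2014, Prop. 3.2.7 (3) (Parseval)] -/
theorem scalarL2Sq_sub_tsum_symbol_sq_le_highModeEnergy {θ : UnitAddTorus d → ℝ} (hθ : Continuous θ) (i : d)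
    (K : ℝ) {m : (d → ℤ) → ℝ} {M : ℝ} (hmM : ∀ k, |m k| ≤ M) (hlow : ∀ k : d → ℤ, |((k i : ℤ) : ℝ)| < K → 1 ≤ m k ^ 2) :
    ENNReal.ofReal (Torus.scalarL2Sq θ - ∑' k, m k ^ 2 * ‖mFourierCoeff (fun x => (θ x : ℂ)) k‖ ^ 2) ≤
      highModeEnergy i K θ := by
  classical
  set c : (d → ℤ) → ℝ := fun k => ‖mFourierCoeff (fun x => (θ x : ℂ)) k‖ ^ 2 with hc
  have hc0 : ∀ k, 0 ≤ c k := fun k => by positivity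
  have hP : HasSum c (Torus.scalarL2Sq θ) := hasSum_sq_norm_mFourierCoeff_scalarL2Sq hθ
  have hM0 : 0 ≤ M := (abs_nonneg _).trans (hmM 0)
  have hm2 : ∀ k, m k ^ 2 ≤ M ^ 2 := fun k => by
    rw [← sq_abs]; exact pow_le_pow_left₀ (abs_nonneg _) (hmM k) 2
  -- the high and low blocks
  set hi : (d → ℤ) → ℝ := fun k => if K ≤ |((k i : ℤ) : ℝ)| then c k else 0 with hhi
  set lo : (d → ℤ) → ℝ := fun k => if K ≤ |((k i : ℤ) : ℝ)| then 0 else c k with hlo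
  have hhi0 : ∀ k, 0 ≤ hi k := fun k => by
    simp only [hhi]; split_ifs; exacts [hc0 k, le_rfl]
  have hlo0 : ∀ k, 0 ≤ lo k := fun k => by
    simp only [hlo]; split_ifs; exacts [le_rfl, hc0 k]
  have hhi_le : ∀ k, hi k ≤ c k := fun k => by
    simp only [hhi]; split_ifs; exacts [le_rfl, hc0 k]
  have hlo_le' : ∀ k, lo k ≤ c k := fun k => by
    simp only [hlo]; split_ifs; exacts [hc0 k, le_rfl]
  have hhi_s : Summable hi := hP.summable.of_nonneg_of_le hhi0 hhi_le
  have hlo_s : Summable lo := hP.summable.of_nonneg_of_le hlo0 hlo_le'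
  have hsplit : Torus.scalarL2Sq θ = ∑' k, hi k + ∑' k, lo k := by
    rw [← hP.tsum_eq, ← hhi_s.tsum_add hlo_s]
    refine tsum_congr fun k => ?_
    simp only [hhi, hlo]
    split_ifs <;> simp
  have hhi_eq : ∑' k, hi k = ∑' k : d → ℤ, if K ≤ |((k i : ℤ) : ℝ)| then ‖mFourierCoeff (fun x => (θ x : ℂ)) k‖ ^ 2 else 0 :=
    tsum_congr fun k => by simp only [hhi, hc]
  -- the low block is dominated by the tracked symbol
  have hsym_s : Summable fun k => m k ^ 2 * c k :=
    (hP.summable.mul_left (M ^ 2)).of_nonneg_of_le (fun k => mul_nonneg (sq_nonneg _) (hc0 k))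
      fun k => mul_le_mul_of_nonneg_right (hm2 k) (hc0 k)
  have hlo_le : ∑' k, lo k ≤ ∑' k, m k ^ 2 * c k := by
    refine hlo_s.tsum_le_tsum (fun k => ?_) hsym_s
    simp only [hlo]
    split_ifs with h
    · exact mul_nonneg (sq_nonneg _) (hc0 k)
    · calc c k = 1 * c k := (one_mul _).symm
        _ ≤ m k ^ 2 * c k := mul_le_mul_of_nonneg_right (hlow k (lt_of_not_ge h)) (hc0 k)
  -- conclude
  rw [highModeEnergy_eq_ofReal_tsum hθ i K, ← hhi_eq]
  refine ENNReal.ofReal_le_ofReal ?_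
  rw [hsplit]
  linarith

end Summit.AnomalousDissipation.AnomalousDissipation.Theorems.SawtoothPulseCascade.SpectralLeakage
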